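import Summits.BirchSwinnertonDyer.BirchSwinnertonDyer.Theorems.QuadraticBranchSignedControlPlusEtaNonsurjMinusCoeffCongruenceHigher
import HarnessLib

/-!
# Route `QuadraticBranchSignedControl` (rung K8, cell `bsd-potss`), residual crux `PlusEtaMainConjectureNonsurj`
# (stmt-BirchSwinnertonDyer-19606): THE λ-INVARIANT OF `L_p⁻(V, η, X)` (when `< p`) READ OFF THE MODULAR SYMBOLS of `θ_{2m+1}(η)`
# (seat `bsd-potss-k8eta-c2` g24; sequel of `…MinusCoeffCongruenceHigher.lean`)

WHY. Every record and census law of this crux speaks of PARI's `λ⁻` (the λ-invariant of the minus branch function: `λ⁻ = 1` on 77 record rows,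
`λ⁻ = 3` on 19, `λ⁻ ≥ 3` defines g19/g22/g23's census populations). The unitriangular identity of the prequel
(`exists_coeff_mazurTate_eq_sum`: `coeff_kθ_{2m+1}(η) = (−1)^{m+1}Σ_{s+t=k}(ω⁺_{2m+1})_s·coeff_tM + p^{2m+1}r`, `(ω⁺)_0 = p^m`, `p^m ∣ (ω⁺)_s`)
makes `λ⁻ < p` a finite symbol datum: THIS FILE proves the reading «for `λ < p`: `v_p(ϖ·coeff_jθ_{2m+1}(η)) ≥ m+1` for `1 ≤ j < λ` and
`v_p(ϖ·coeff_λθ_{2m+1}(η)) = m` ⟹ `coeff_jL ∉ ℤ_pˣ` (`j < λ`) and `coeff_λL ∈ ℤ_pˣ`» for EVERY `L` with `IsQuadraticBranchMinusLFunction f p ϖ L`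
(`‖ϖ‖_p ≤ 1`) — i.e. `μ(L) = 0 ∧ λ(L) = λ`. Numerically (k8eta-c2 g24 P-24E, 100 rows at p = 5, levels 1 and 3): 18/18 `λ⁻ = 3` rows, 5/5
`λ⁻ = 5` rows (one-sided), 77/77 `λ⁻ = 1` rows agree with PARI.

WHAT. §10 `norm_sub_le_of_forall_norm_le` (one step of the triangular induction: `‖ϖθ_k − (−1)^{m+1}p^mϖM_k‖ ≤ p^{−(m+1)}` once `‖ϖM_t‖ ≤ p^{−1}`
for `t < k`), `forall_norm_le_of_forall_norm_theta_le` (the induction), `lambda_reading_of_padicNorm` (the reading for every `L`).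

HONEST FRAMING (cell `bsd-potss`; FULL-BSD rank ≤ 1 programme, HUMAN RULING D-0036/D-0074): TOOL THEOREMS ONLY — no definition, no named fact,
no `sorry`, axioms standard; nothing about (A), (C1⁺_η), C-cc-1 or `BSD(W,p)` of any pair is claimed; no stub of 19606 is proved; crux and route
OPEN; nothing booked. `--supports stmt-BirchSwinnertonDyer-19606`.

References: [Pollack2003] Prop. 6.18; [Kobayashi2003] Thm. 3.2, (3.5), (3.7) (p. 7); [Washington1997] §7.1 (λ, μ of an Iwasawa function).
-/

set_option autoImplicit false
set_option linter.dupNamespace false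
noncomputable section

open scoped Classical MatrixGroups ModularForm

open CongruenceSubgroup Polynomial Literature.NumberTheory.EllipticCurves
  Literature.NumberTheory.EllipticCurves.ModularForms
open Summit.BirchSwinnertonDyer.Rank1Residual.Additive

namespace Summit.BirchSwinnertonDyer.BirchSwinnertonDyer.Theorems.EtaMinusCoeffCongruence

variable {p : ℕ} [hp : Fact p.Prime] {N : ℕ} [NeZero N] {f : CuspForm (Gamma0 N) 2}

/-! ## §10 The λ-reading -/

/-- **One step of the triangular induction.** From the identity
`coeff_kθ = (−1)^{m+1}Σ_{s+t=k}(ω⁺_{2m+1})_s·coeff_tM + p^{2m+1}r` (`k < p`), `‖ϖ‖_p ≤ 1` and `‖ϖ·coeff_tM‖ ≤ p^{−1}` for all `t < k`: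
`‖ϖ·coeff_kθ − (−1)^{m+1}p^m·ϖ·coeff_kM‖ ≤ p^{−(m+1)}` (the off-diagonal terms have `p^m ∣ (ω⁺)_s`, `s ≥ 1`, times a factor of norm `≤ p^{−1}`;
the remainder has norm `≤ p^{−(2m+1)}`). [cite: Pollack2003, Prop. 6.18] -/
theorem norm_sub_le_of_forall_norm_le (m : ℕ) {k : ℕ} (hk : k < p) {M : IwasawaAlgebra p} {θk : ℚ_[p]} {r : ℤ_[p]}
    (hid : θk = (-1) ^ (m + 1) * (∑ x ∈ Finset.HasAntidiagonal.antidiagonal k,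
        (((cyclotomicOmegaPlus p (2 * m + 1)).coeff x.1 : ℤ) : ℚ_[p]) * ((PowerSeries.coeff x.2 M : ℤ_[p]) : ℚ_[p])) +
        (p : ℚ_[p]) ^ (2 * m + 1) * (r : ℚ_[p]))
    {ϖ : ℚ_[p]} (hϖ : ‖ϖ‖ ≤ 1)
    (hIH : ∀ t < k, ‖ϖ * ((PowerSeries.coeff t M : ℤ_[p]) : ℚ_[p])‖ ≤ (p : ℝ)⁻¹) :
    ‖ϖ * θk - (-1) ^ (m + 1) * (p : ℚ_[p]) ^ m * (ϖ * ((PowerSeries.coeff k M : ℤ_[p]) : ℚ_[p]))‖ ≤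
      ((p : ℝ)⁻¹) ^ (m + 1) := by
  have hP : p.Prime := hp.out
  have hp1 : (1 : ℝ) < p := by exact_mod_cast hP.one_lt
  have hp0 : (0 : ℝ) < p := by positivity
  have hpi0 : (0 : ℝ) ≤ (p : ℝ)⁻¹ := inv_nonneg.mpr hp0.le
  have hpi1 : (p : ℝ)⁻¹ ≤ 1 := inv_le_one_of_one_le₀ hp1.le
  set S := Finset.HasAntidiagonal.antidiagonal k with hS
  set g : ℕ × ℕ → ℚ_[p] := fun x ↦
    (((cyclotomicOmegaPlus p (2 * m + 1)).coeff x.1 : ℤ) : ℚ_[p]) * ((PowerSeries.coeff x.2 M : ℤ_[p]) : ℚ_[p]) with hg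
  have hmem : ((0, k) : ℕ × ℕ) ∈ S := by rw [hS, Finset.HasAntidiagonal.mem_antidiagonal]; simp
  have hsplit := Finset.add_sum_erase S g hmem
  have hg0 : g (0, k) = (p : ℚ_[p]) ^ m * ((PowerSeries.coeff k M : ℤ_[p]) : ℚ_[p]) := by
    rw [hg]
    dsimp only
    rw [coeff_zero_cyclotomicOmegaPlus_two_mul_add_one]
    push_cast
    ring
  -- the difference is `ε ϖ Σ_{erase} + p^n ϖ r`
  have hms : ϖ * ∑ x ∈ S.erase (0, k), g x = ∑ x ∈ S.erase (0, k), ϖ * g x := by rw [Finset.mul_sum]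
  have hdiff : ϖ * θk - (-1) ^ (m + 1) * (p : ℚ_[p]) ^ m * (ϖ * ((PowerSeries.coeff k M : ℤ_[p]) : ℚ_[p])) =
      (-1) ^ (m + 1) * ∑ x ∈ S.erase (0, k), ϖ * g x + (p : ℚ_[p]) ^ (2 * m + 1) * (ϖ * (r : ℚ_[p])) := by
    rw [← hms, hid, ← hsplit, hg0]
    ring
  rw [hdiff]
  -- bound each off-diagonal term
  have hterm : ∀ x ∈ S.erase (0, k), ‖ϖ * g x‖ ≤ ((p : ℝ)⁻¹) ^ (m + 1) := by
    intro x hx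
    obtain ⟨hne, hxS⟩ := Finset.mem_erase.mp hx
    have hsum : x.1 + x.2 = k := by rw [hS] at hxS; exact Finset.HasAntidiagonal.mem_antidiagonal.mp hxS
    have hx1 : 1 ≤ x.1 := by
      rcases Nat.eq_zero_or_pos x.1 with h0 | h0
      · exact absurd (Prod.ext h0 (by show x.2 = k; omega)) hne
      · exact h0
    have hx1lt : x.1 < p * (p - 1) := by
      have : k < p * (p - 1) := lt_of_lt_of_le hk (Nat.le_mul_of_pos_right p (by have := hP.two_le; omega))
      omega
    have hdvd := pow_dvd_coeff_cyclotomicOmegaPlus_two_mul_add_one (p := p) m x.1 hx1lt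
    have hω : ‖(((cyclotomicOmegaPlus p (2 * m + 1)).coeff x.1 : ℤ) : ℚ_[p])‖ ≤ (p : ℝ) ^ (-(m : ℤ)) :=
      (Padic.norm_int_le_pow_iff_dvd _ _).mpr (by exact_mod_cast hdvd)
    have hMt := hIH x.2 (by omega)
    rw [hg]
    dsimp only
    calc ‖ϖ * ((((cyclotomicOmegaPlus p (2 * m + 1)).coeff x.1 : ℤ) : ℚ_[p]) *
          ((PowerSeries.coeff x.2 M : ℤ_[p]) : ℚ_[p]))‖
        = ‖(((cyclotomicOmegaPlus p (2 * m + 1)).coeff x.1 : ℤ) : ℚ_[p])‖ *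
            ‖ϖ * ((PowerSeries.coeff x.2 M : ℤ_[p]) : ℚ_[p])‖ := by
          rw [← norm_mul]; ring_nf
      _ ≤ (p : ℝ) ^ (-(m : ℤ)) * (p : ℝ)⁻¹ := mul_le_mul hω hMt (norm_nonneg _) (by positivity)
      _ = ((p : ℝ)⁻¹) ^ (m + 1) := by rw [zpow_neg, zpow_natCast, ← inv_pow, pow_succ]
  have hsum_le : ‖∑ x ∈ S.erase (0, k), ϖ * g x‖ ≤ ((p : ℝ)⁻¹) ^ (m + 1) :=
    IsUltrametricDist.norm_sum_le_of_forall_le_of_nonneg (by positivity) hterm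
  have hA : ‖(-1 : ℚ_[p]) ^ (m + 1) * ∑ x ∈ S.erase (0, k), ϖ * g x‖ ≤ ((p : ℝ)⁻¹) ^ (m + 1) := by
    rw [norm_mul, norm_pow, norm_neg, norm_one, one_pow, one_mul]; exact hsum_le
  have hB : ‖(p : ℚ_[p]) ^ (2 * m + 1) * (ϖ * (r : ℚ_[p]))‖ ≤ ((p : ℝ)⁻¹) ^ (m + 1) := by
    rw [norm_mul, norm_mul, norm_pow, Padic.norm_p, PadicInt.padic_norm_e_of_padicInt]
    calc ((p : ℝ)⁻¹) ^ (2 * m + 1) * (‖ϖ‖ * ‖r‖) ≤ ((p : ℝ)⁻¹) ^ (2 * m + 1) * (1 * 1) := by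
          gcongr
          exact PadicInt.norm_le_one r
      _ ≤ ((p : ℝ)⁻¹) ^ (m + 1) := by
          rw [mul_one, mul_one]; exact pow_le_pow_of_le_one hpi0 hpi1 (by omega)
  exact (IsUltrametricDist.norm_add_le_max _ _).trans (max_le hA hB)

/-- **The triangular induction.** `p` odd, `f` a rational newform of level prime to `p` with `a_p = 0`, `M` the odd-level Mazur–Tate limit
(`M(0) = 0` and the congruences), `‖ϖ‖_p ≤ 1`, `λ < p`: if `‖ϖ·coeff_jθ_{2m+1}(η)‖ ≤ p^{−(m+1)}` for all `1 ≤ j < λ` then `‖ϖ·coeff_jM‖ ≤ p^{−1}`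
for all `j < λ`. [cite: Pollack2003, Prop. 6.18] -/
theorem forall_norm_le_of_forall_norm_theta_le (hp2 : p ≠ 2) (hf0 : IsNewform0 f) (hQ : coeffField f = ⊥)
    (hpN : ¬ p ∣ N) (hap : cuspCoeff f p = ((0 : ℤ) : ℂ)) (m : ℕ) {lam : ℕ} (hlam : lam < p) {M : IwasawaAlgebra p}
    (hM0 : PowerSeries.constantCoeff M = 0)
    (hM : IsCongrModOmega p (2 * m + 1) (quadraticBranchMazurTateElement p f (2 * m + 1))
      ((-1) ^ (m + 1) * cyclotomicOmegaPlus p (2 * m + 1)) M)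
    {ϖ : ℚ_[p]} (hϖ : ‖ϖ‖ ≤ 1)
    (hθ : ∀ j, 1 ≤ j → j < lam →
      ‖ϖ * (((quadraticBranchMazurTateElement p f (2 * m + 1)).coeff j : ℚ) : ℚ_[p])‖ ≤ ((p : ℝ)⁻¹) ^ (m + 1)) :
    ∀ j < lam, ‖ϖ * ((PowerSeries.coeff j M : ℤ_[p]) : ℚ_[p])‖ ≤ (p : ℝ)⁻¹ := by
  have hP : p.Prime := hp.out
  have hp1 : (1 : ℝ) < p := by exact_mod_cast hP.one_lt
  have hp0 : (0 : ℝ) < p := by positivity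
  intro j
  induction j using Nat.strong_induction_on with
  | _ j ih =>
    intro hj
    rcases Nat.eq_zero_or_pos j with rfl | hj0
    · rw [PowerSeries.coeff_zero_eq_constantCoeff_apply, hM0, PadicInt.coe_zero, mul_zero, norm_zero]
      positivity
    · obtain ⟨r, hr⟩ := exists_coeff_mazurTate_eq_sum hp2 hf0 hQ hpN hap m (show j < p by omega) hM
      have hstep := norm_sub_le_of_forall_norm_le m (show j < p by omega) hr hϖ (fun t ht ↦ ih t ht (by omega))
      have hθj := hθ j hj0 hj
      -- `‖ε p^m ϖ M_j‖ ≤ p^{-(m+1)}` by the ultrametric inequality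
      set a : ℚ_[p] := ϖ * (((quadraticBranchMazurTateElement p f (2 * m + 1)).coeff j : ℚ) : ℚ_[p]) with ha
      set b : ℚ_[p] := (-1 : ℚ_[p]) ^ (m + 1) * (p : ℚ_[p]) ^ m *
        (ϖ * ((PowerSeries.coeff j M : ℤ_[p]) : ℚ_[p])) with hb
      have hle : ‖b‖ ≤ ((p : ℝ)⁻¹) ^ (m + 1) := by
        have e : b = a + -(a - b) := by ring
        rw [e]
        refine (IsUltrametricDist.norm_add_le_max _ _).trans (max_le hθj ?_)
        rw [norm_neg]
        exact hstep
      rw [hb] at hle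
      rw [norm_mul, norm_mul, norm_pow, norm_neg, norm_one, one_pow, one_mul, norm_pow, Padic.norm_p, pow_succ] at hle
      have hpm : (0 : ℝ) < ((p : ℝ)⁻¹) ^ m := pow_pos (inv_pos.mpr hp0) m
      exact le_of_mul_le_mul_left hle hpm

/-- **THE λ-READING.** `p` odd, `f` a rational newform of level `N` prime to `p` with `a_p(f) = 0`, `ϖ ∈ ℚ` with `‖ϖ‖_p ≤ 1`, `L` ANY function with
`IsQuadraticBranchMinusLFunction f p ϖ L`, `λ < p`, `m ≥ 0`. DISPLAYED (finite symbol data, `θ = quadraticBranchMazurTateElement p f (2m+1)`):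
`‖ϖ·coeff_jθ‖_p ≤ p^{−(m+1)}` for `1 ≤ j < λ` and `‖ϖ·coeff_λθ‖_p = p^{−m}`. CONCLUSION: `coeff_jL ∉ ℤ_pˣ` for every `j < λ` and
`coeff_λL ∈ ℤ_pˣ` — `μ(L) = 0` and `λ(L) = λ`: the λ-invariant of `L_p⁻(V,η,X)` read off `λ+1` exact rationals. [cite: Pollack2003, Prop. 6.18]
[cite: Kobayashi2003, Thm. 3.2, (3.5), (3.7) (p. 7)] [cite: Washington1997, §7.1] -/
theorem lambda_reading_of_padicNorm (hp2 : p ≠ 2) (hf0 : IsNewform0 f) (hQ : coeffField f = ⊥)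
    (hpN : ¬ p ∣ N) (hap : cuspCoeff f p = ((0 : ℤ) : ℂ)) {ϖ : ℚ} (hϖ : ‖(ϖ : ℚ_[p])‖ ≤ 1)
    {L : IwasawaAlgebra p} (hL : IsQuadraticBranchMinusLFunction f p ϖ L) (m : ℕ) {lam : ℕ} (hlam : lam < p)
    (hlow : ∀ j, 1 ≤ j → j < lam →
      ‖(ϖ : ℚ_[p]) * (((quadraticBranchMazurTateElement p f (2 * m + 1)).coeff j : ℚ) : ℚ_[p])‖ ≤ ((p : ℝ)⁻¹) ^ (m + 1))
    (htop : ‖(ϖ : ℚ_[p]) * (((quadraticBranchMazurTateElement p f (2 * m + 1)).coeff lam : ℚ) : ℚ_[p])‖ = ((p : ℝ)⁻¹) ^ m) :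
    (∀ j < lam, ¬ IsUnit (PowerSeries.coeff j L)) ∧ IsUnit (PowerSeries.coeff lam L) := by
  have hP : p.Prime := hp.out
  have hp1 : (1 : ℝ) < p := by exact_mod_cast hP.one_lt
  have hp0 : (0 : ℝ) < p := by positivity
  obtain ⟨M, hM⟩ := exists_isCongrModOmega_quadraticBranch_odd hp2 hf0 hQ hpN hap
  have hM0 : PowerSeries.constantCoeff M = 0 :=
    (isQuadraticBranchMinusLFunction_one_of_isCongrModOmega hp2 hf0 hQ hpN hap hM).1
  obtain ⟨v, hv⟩ := exists_units_forall_coeff_eq hp2 hf0 hQ hpN hap hϖ hL hM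
  have hsmall := forall_norm_le_of_forall_norm_theta_le hp2 hf0 hQ hpN hap m hlam hM0 (hM m) hϖ hlow
  have hnormL : ∀ j, ‖PowerSeries.coeff j L‖ = ‖(ϖ : ℚ_[p]) * ((PowerSeries.coeff j M : ℤ_[p]) : ℚ_[p])‖ := by
    intro j
    rw [PadicInt.norm_def, hv j, norm_mul, PadicInt.padic_norm_e_of_padicInt, PadicInt.norm_units, one_mul]
  refine ⟨fun j hj hu ↦ ?_, ?_⟩
  · have h1 : ‖PowerSeries.coeff j L‖ = 1 := PadicInt.isUnit_iff.mp hu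
    rw [hnormL] at h1
    have h2 := hsmall j hj
    rw [h1] at h2
    exact absurd h2 (not_le.mpr (inv_lt_one_of_one_lt₀ hp1))
  · -- the top coefficient: `‖ε p^m ϖ M_λ‖ = ‖ϖ θ_λ‖ = p^{-m}`
    obtain ⟨r, hr⟩ := exists_coeff_mazurTate_eq_sum hp2 hf0 hQ hpN hap m hlam (hM m)
    have hstep := norm_sub_le_of_forall_norm_le m hlam hr hϖ hsmall
    set a : ℚ_[p] := (ϖ : ℚ_[p]) * (((quadraticBranchMazurTateElement p f (2 * m + 1)).coeff lam : ℚ) : ℚ_[p]) with ha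
    set b : ℚ_[p] := (-1 : ℚ_[p]) ^ (m + 1) * (p : ℚ_[p]) ^ m *
      ((ϖ : ℚ_[p]) * ((PowerSeries.coeff lam M : ℤ_[p]) : ℚ_[p])) with hb
    have hlt : ‖a - b‖ < ‖a‖ := by
      rw [htop]
      refine hstep.trans_lt ?_
      rw [pow_succ]
      exact mul_lt_of_lt_one_right (pow_pos (inv_pos.mpr hp0) m) (inv_lt_one_of_one_lt₀ hp1)
    have hnb : ‖b‖ = ‖a‖ := by
      have h := Padic.add_eq_max_of_ne (p := p) (q := a - b) (r := b) (by
        intro heq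
        rw [heq] at hlt
        have := IsUltrametricDist.norm_add_le_max (a - b) b
        rw [sub_add_cancel, heq, max_self] at this
        exact absurd (lt_of_le_of_lt this hlt) (lt_irrefl _))
      rw [sub_add_cancel] at h
      rcases le_total ‖a - b‖ ‖b‖ with hle | hle
      · rw [max_eq_right hle] at h; exact h.symm
      · rw [max_eq_left hle] at h; exact absurd h (ne_of_gt hlt)
    rw [htop, hb, norm_mul, norm_mul, norm_pow, norm_neg, norm_one, one_pow, one_mul, norm_pow, Padic.norm_p] at hnb
    have hone : ‖(ϖ : ℚ_[p]) * ((PowerSeries.coeff lam M : ℤ_[p]) : ℚ_[p])‖ = 1 := by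
      have hpm : ((p : ℝ)⁻¹) ^ m ≠ 0 := pow_ne_zero _ (inv_ne_zero hp0.ne')
      field_simp at hnb
      linarith [hnb]
    exact PadicInt.isUnit_iff.mpr (by rw [hnormL, hone])

end Summit.BirchSwinnertonDyer.BirchSwinnertonDyer.Theorems.EtaMinusCoeffCongruence

end
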